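import Mathlib
import Summits.Langlands.Langlands.Theorems.IrreducibilityBySelfDualityHeckeEigenvalueFieldStubLiftDiff
import Summits.Langlands.Langlands.Theorems.IrreducibilityBySelfDualityHeckeEigenvalueFieldStubEndScalarSmooth
import Literature.NumberTheory.Automorphic.ResGLnConeDictionaryCone
import Literature.NumberTheory.Automorphic.ResGLnKugaHarmonic
import Literature.NumberTheory.Automorphic.PosFormTensorProduct
import HarnessLib

/-!
# The cochain identity of the lift as a function identity, and coordinates —
crux `HeckeEigenvalueField` (stmt-Langlands-13632), line `Sketch`, stub END-SCALAR, part IDENTITY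

Namespace `Summit.Langlands.Langlands.Theorems.HeckeEigenvalueField.Res`.  Theorems only; the
ResConeAnalytic preamble (this file combines the registered P1/P2 of END-SCALAR with LIFT-DIFF).

* `repr_evalTensor_eq_coordT` — the `k`-th coordinate (basis `b` of `E`) of `evalTensor t x` is the value
  at `x` of the cusp form `coordT b t k` (`Kuga.coordT`, tensor induction);
* `repr_apply_eq_sum_repr` — `(A e)_k = ∑_{k'} (A b_{k'})_k e_{k'}`;
* `stub_endScalar_identity` (registered sub-stub) — for a level-fixed cochain `η` of the
  `(𝔤, K_∞)`-complex, a family `β` with P1 (smooth on the cone) and P2 (`dβ_c = coneForm η c.out`), its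
  lift `u` and a tuple `x_I` of the hermitian basis `xD` of `𝔭₀`:
  `∑ᵢ (-1)ⁱ (d/dt|₀ u(x_{I∖i})(g e^{t x_{I i}}, c) + dE(x_{I i}) u(x_{I∖i})(g, c)) = η(x_I)(g, c)` in `E_λ(ℂ)`,
  for every `g ∈ G_∞` and every finite-adelic `c`: LIFT-DIFF (`stub_lift_differential`, with `hσd` from
  `hasDerivAt_σS_inv` of part SMOOTH), `dβ = ω`, `coneForm_mul_of_isLevelFixed` (any representative of the
  level coset) and the pullback identity `coneForm_apply_tangent` unfolded to `E(g) η(Y)(g, c)`.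

Reference: A. Borel, N. Wallach (2000), I §5.1, VII 2.2–2.5. [BorelWallach2000]
-/

set_option linter.dupNamespace false -- project-wide: `Summit.Langlands.Langlands` is the mandated namespace

noncomputable section

-- as in LIFT-D / LIFT-DIFF: product-topology vs normed instance paths on `M_n(K_∞)` unfold `Matrix`
set_option backward.isDefEq.respectTransparency false

open scoped Classical Matrix Matrix.Norms.Operator Topology TensorProduct ContDiff
open Filter NumberField NumberField.mixedEmbedding Literature.NumberTheory.Automorphic
open Literature.NumberTheory.Automorphic.RealMatrixGroup

-- ResConeAnalytic preamble: ONE topology on `M_n(K_∞)` (the operator norm), as in the registered END-SCALAR.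
attribute [-instance] instTopologicalSpaceMatrix
attribute [-instance] Matrix.instUniformSpace
attribute [local instance high] NormedAddCommGroup.toSeminormedAddCommGroup

namespace Summit.Langlands.Langlands.Theorems.HeckeEigenvalueField.Res

/-- **Coordinates of an evaluated tensor**: the `k`-th coordinate of `evalTensor t x` in a basis `b` of
`E` is the value at `x` of the `k`-th coordinate `coordT b t k ∈ W` of `t`. [folklore] -/
theorem repr_evalTensor_eq_coordT {n : ℕ} {K : Type} [Field K] [NumberField K]
    {hcpt : isCompact_glFiniteIntegralLevel n K} (π : AutomorphicRepData (AutomorphyDatum.gl n K hcpt))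
    {E : Type*} [AddCommGroup E] [Module ℂ E] {ι : Type*} [Fintype ι]
    (b : Module.Basis ι ℂ E) (t : π.W ⊗[ℂ] E) (k : ι) (x : (AdelicGroupData.gl n K).Adelic) :
    b.repr (π.evalTensor E t x) k = ((Kuga.coordT b t k : π.W) : (AdelicGroupData.gl n K).Adelic → ℂ) x := by
  induction t using TensorProduct.induction_on with
  | zero => simp only [map_zero, Pi.zero_apply, Finsupp.coe_zero, Submodule.coe_zero]
  | tmul ψ e =>
    rw [AutomorphicRepData.evalTensor_tmul, map_smul, Finsupp.coe_smul, Pi.smul_apply, smul_eq_mul,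
      Kuga.coordT_tmul, Submodule.coe_smul, Pi.smul_apply, smul_eq_mul, mul_comm]
  | add t t' ht ht' =>
    simp only [map_add, Pi.add_apply, Finsupp.coe_add, Submodule.coe_add, ht, ht']

/-- **Coordinates of `A e`** in a basis `b`: `(A e)_k = ∑_{k'} (A b_{k'})_k e_{k'}`. [folklore] -/
theorem repr_apply_eq_sum_repr {E : Type*} [AddCommGroup E] [Module ℂ E] {ι : Type*} [Fintype ι]
    (b : Module.Basis ι ℂ E) (A : E →ₗ[ℂ] E) (e : E) (k : ι) :
    b.repr (A e) k = ∑ k', b.repr (A (b k')) k * b.repr e k' := by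
  conv_lhs => rw [← b.sum_repr e]
  rw [map_sum, map_sum, Finset.sum_apply']
  refine Finset.sum_congr rfl fun k' _ => ?_
  rw [map_smul, map_smul, Finsupp.smul_apply, smul_eq_mul, mul_comm]

variable {n : ℕ} {K : Type} [Field K] [NumberField K]

set_option maxHeartbeats 800000 in
-- the datum-typed statement and the chain through LIFT-DIFF / the cone dictionary are large
/-- **Stub END-SCALAR, part IDENTITY — the cochain identity of the lift, as an `E_λ(ℂ)`-valued function
identity.**  For a level-fixed cochain `η` of the `(𝔤, K_∞)`-complex, a family `β_c` smooth on the cone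
with `dβ_c = ω_c = coneForm η c.out` (P1, P2), its lift `u` (LIFT) and a tuple `x_I` of the hermitian
basis `xD` of `𝔭₀`:
`∑ᵢ (-1)ⁱ ( d/dt|₀ u(x_{I∖i})(g e^{t x_{I i}}, c) + dE(x_{I i}) u(x_{I∖i})(g, c) ) = η(x_I)(g, c)`
for every `g ∈ G_∞` and EVERY finite-adelic `c` — LIFT-DIFF (`hσd` from `hasDerivAt_σS_inv`,
differentiability from P1 on the open cone), `dβ = ω` (P2), independence of the representative of the
level coset (`coneForm_mul_of_isLevelFixed`), and the pullback identity `coneForm_apply_tangent`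
(`tg_g Y = (gY)gᴴ + g(gY)ᴴ`), which unfolds to `E(g) · η(Y)(g, c)`.
[cite: BorelWallach2000, VII 2.2–2.5] -/
theorem stub_endScalar_identity {n : ℕ} {K : Type} [Field K] [NumberField K]
    (hcpt : isCompact_glFiniteIntegralLevel n K) (𝔫 : Ideal (𝓞 K))
    (π : AutomorphicRepData (AutomorphyDatum.gl n K hcpt))
    (S : Finset {w : InfinitePlace K // w.IsReal}) (lam : (K →+* ℂ) → Fin n → ℤ) {q : ℕ}
    {η : ConeDictionary.Cochain π lam (q + 1)} (hη : η ∈ (ConeDictionary.gkComplexLS π S lam).cocycles (q + 1))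
    (hfix : ConeDictionary.IsLevelFixed π lam 𝔫 η)
    (sq : (AutomorphyDatum.gl n K hcpt).arch.carrier → ResGLnCone.hermSpace n K)
    (hsq : ∀ h : (AutomorphyDatum.gl n K hcpt).arch.carrier,
      (sq h : Matrix (Fin n) (Fin n) (mixedSpace K)) =
        ((h : GL (Fin n) (mixedSpace K)) : Matrix (Fin n) (Fin n) (mixedSpace K)) *
          (((h : GL (Fin n) (mixedSpace K)) : Matrix (Fin n) (Fin n) (mixedSpace K)))ᴴ)
    (tg : (AutomorphyDatum.gl n K hcpt).arch.carrier → (AutomorphyDatum.gl n K hcpt).arch.lie →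
      ResGLnCone.hermSpace n K)
    (htg : ∀ (h : (AutomorphyDatum.gl n K hcpt).arch.carrier) (Y : (AutomorphyDatum.gl n K hcpt).arch.lie),
      (tg h Y : Matrix (Fin n) (Fin n) (mixedSpace K)) =
        ((h : GL (Fin n) (mixedSpace K)) : Matrix (Fin n) (Fin n) (mixedSpace K)) *
            (Y : Matrix (Fin n) (Fin n) (mixedSpace K)) *
            (((h : GL (Fin n) (mixedSpace K)) : Matrix (Fin n) (Fin n) (mixedSpace K)))ᴴ +
          ((h : GL (Fin n) (mixedSpace K)) : Matrix (Fin n) (Fin n) (mixedSpace K)) *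
            (Y : Matrix (Fin n) (Fin n) (mixedSpace K))ᴴ *
            (((h : GL (Fin n) (mixedSpace K)) : Matrix (Fin n) (Fin n) (mixedSpace K)))ᴴ)
    (β : (BigHeckeGLn.FiniteAdelicGL n K ⧸ ResGLnCohomology.level n K 𝔫) →
      ResGLnCone.hermSpace n K → ResGLnCone.hermSpace n K [⋀^Fin q]→L[ℝ] ResGLnCohomology.CoeffModule ℂ n K lam)
    (hβs : ∀ c, ContDiffOn ℝ ((⊤ : ℕ∞) : WithTop ℕ∞)
      (fun H => @id (ResGLnCone.hermSpace n K [⋀^Fin q]→L[ℝ] ResGLnCohomology.CoeffModule ℂ n K lam) (β c H))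
      (ResGLnCone.posCone n K))
    (hβd : ∀ c, ∀ H ∈ ResGLnCone.posCone n K,
      extDeriv (fun H' => @id (ResGLnCone.hermSpace n K [⋀^Fin q]→L[ℝ] ResGLnCohomology.CoeffModule ℂ n K lam)
          (β c H')) H =
        @id (ResGLnCone.hermSpace n K [⋀^Fin (q + 1)]→L[ℝ] ResGLnCohomology.CoeffModule ℂ n K lam)
          (ConeDictionary.coneForm π S lam η c.out H))
    (u : (Fin q → (AutomorphyDatum.gl n K hcpt).arch.lie) → (AutomorphyDatum.gl n K hcpt).arch.carrier →
      BigHeckeGLn.FiniteAdelicGL n K → ResGLnCohomology.CoeffModule ℂ n K lam)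
    (hu : ∀ Yt g c, u Yt g c = ConeDictionary.σS hcpt S lam g⁻¹
      (β (c : BigHeckeGLn.FiniteAdelicGL n K ⧸ ResGLnCohomology.level n K 𝔫) (sq g) (fun i => tg g (Yt i))))
    (I : Fin (q + 1) → Fin (ResGLnCartan.pZeroDim n K)) (g : (AutomorphyDatum.gl n K hcpt).arch.carrier)
    (c : BigHeckeGLn.FiniteAdelicGL n K) :
    ∑ i : Fin (q + 1), ((-1 : ℂ) ^ (i : ℕ)) •
        (deriv (fun t : ℝ => u (fun j => ConeDictionary.xD n K hcpt (I (i.succAbove j)))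
            (g * (AutomorphyDatum.gl n K hcpt).arch.expMem (t • ConeDictionary.xD n K hcpt (I i))) c) 0 +
          ConeDictionary.σ𝔤S hcpt lam (ConeDictionary.xD n K hcpt (I i))
            (u (fun j => ConeDictionary.xD n K hcpt (I (i.succAbove j))) g c)) =
      π.evalTensor (ResGLnCohomology.CoeffModule ℂ n K lam)
        (@id (π.W ⊗[ℂ] ResGLnCohomology.CoeffModule ℂ n K lam) (η (fun i => ConeDictionary.xD n K hcpt (I i))))
        (ConeDictionary.adelicPt hcpt g c) := by
  have hηc : η ∈ (ConeDictionary.gkComplexLS π S lam).carrier (q + 1) :=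
    (((ConeDictionary.gkComplexLS π S lam).mem_cocycles_iff (q + 1) η).1 hη).1
  set Y : Fin (q + 1) → (AutomorphyDatum.gl n K hcpt).arch.lie := fun i => ConeDictionary.xD n K hcpt (I i) with hY_def
  have hY : ∀ i, ((Y i : (AutomorphyDatum.gl n K hcpt).arch.lie) : Matrix (Fin n) (Fin n) (mixedSpace K))ᴴ =
      ((Y i : (AutomorphyDatum.gl n K hcpt).arch.lie) : Matrix (Fin n) (Fin n) (mixedSpace K)) :=
    fun i => ConeDictionary.conjTranspose_xD n K hcpt (I i)
  have hpos : sq g ∈ ResGLnCone.posCone n K := sq_mem_posCone hcpt sq hsq g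
  have hdiff : DifferentiableAt ℝ (β (c : BigHeckeGLn.FiniteAdelicGL n K ⧸ ResGLnCohomology.level n K 𝔫)) (sq g) :=
    ((hβs _).contDiffAt ((ResGLnCone.isOpen_posCone n K).mem_nhds hpos)).differentiableAt (by simp)
  -- LIFT-DIFF
  have hL := stub_lift_differential hcpt 𝔫 S lam sq hsq tg htg β (fun g Y v => hasDerivAt_σS_inv hcpt S lam g Y v)
    u hu g c hdiff Y hY
  refine hL.trans ?_
  -- `dβ = ω` at `sq g`, and the representative of the coset
  obtain ⟨v, hv⟩ := QuotientGroup.mk_out_eq_mul (ResGLnCohomology.level n K 𝔫) c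
  have hP2 := hβd (c : BigHeckeGLn.FiniteAdelicGL n K ⧸ ResGLnCohomology.level n K 𝔫) (sq g) hpos
  have hext : extDeriv (β (c : BigHeckeGLn.FiniteAdelicGL n K ⧸ ResGLnCohomology.level n K 𝔫)) (sq g)
      (fun i => tg g (Y i)) = ConeDictionary.coneForm π S lam η c (sq g) (fun i => tg g (Y i)) := by
    have h := congrFun (congrArg DFunLike.coe hP2) (fun i => tg g (Y i))
    rw [hv, ConeDictionary.coneForm_mul_of_isLevelFixed π S lam hfix c v.2] at h
    exact h
  rw [hext]
  -- the pullback identity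
  have hg : (((g : (AutomorphyDatum.gl n K hcpt).arch.carrier) : GL (Fin n) (mixedSpace K)) :
        Matrix (Fin n) (Fin n) (mixedSpace K)) *
      ((((g : (AutomorphyDatum.gl n K hcpt).arch.carrier) : GL (Fin n) (mixedSpace K)) :
        Matrix (Fin n) (Fin n) (mixedSpace K)))ᴴ = (sq g : Matrix (Fin n) (Fin n) (mixedSpace K)) := (hsq g).symm
  have htan := ConeDictionary.coneForm_apply_tangent π S lam hηc c g hg
    (fun i => (((g : (AutomorphyDatum.gl n K hcpt).arch.carrier) : GL (Fin n) (mixedSpace K)) :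
      Matrix (Fin n) (Fin n) (mixedSpace K)) * (Y i : Matrix (Fin n) (Fin n) (mixedSpace K)))
    (fun i => tg g (Y i)) (fun i => by
      rw [htg, Matrix.conjTranspose_mul]
      simp only [Matrix.mul_assoc])
  rw [htan, ConeDictionary.leftTrivForm_apply, ConeDictionary.leftForm_apply, ConeDictionary.archOfMatrix_coe_datum,
    ConeDictionary.leftFormAlg_apply, ConeDictionary.twistedEval_apply]
  have hinv : ∀ i, Ring.inverse ((((g : (AutomorphyDatum.gl n K hcpt).arch.carrier) : GL (Fin n) (mixedSpace K)) :
      Matrix (Fin n) (Fin n) (mixedSpace K))) *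
      ((((g : (AutomorphyDatum.gl n K hcpt).arch.carrier) : GL (Fin n) (mixedSpace K)) :
        Matrix (Fin n) (Fin n) (mixedSpace K)) * (Y i : Matrix (Fin n) (Fin n) (mixedSpace K))) =
      (Y i : Matrix (Fin n) (Fin n) (mixedSpace K)) := fun i => by
    rw [Ring.inverse_unit, Units.inv_mul_cancel_left]
  simp only [hinv, ConeDictionary.toLie_coe]
  rw [← Module.End.mul_apply, ← map_mul, inv_mul_cancel, map_one, Module.End.one_apply]

end Summit.Langlands.Langlands.Theorems.HeckeEigenvalueField.Res

end
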